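import Literature.MathematicalPhysics.QuantumFieldTheory.Balaban1983to89.B2LargeField
import Literature.MathematicalPhysics.QuantumFieldTheory.Balaban1983to89.B2Sect3AGaussianStep
import Literature.MathematicalPhysics.QuantumFieldTheory.Balaban1983to89.B1Ineq352Proof

/-!
# `Balaban1983to89.B2Prop31Thresholds` — [Balaban1982Higgs2] Proposition 3.1 (3.26) p. 589 / (3.29) p. 590: the PRINTED
THRESHOLDS of the restrictions (2.55)/(3.15)/(2.17) and of Lemma 2.3 (2.59)/(2.60) written in the PHYSICAL units of the
`HiggsLattice` carrier, and the three arithmetic lemmas that turn them into the inputs of the cell's (3.29) theorem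
`B2Ineq329RegularField.ineq329_regular_concrete`: the regularity modulus `δ_k = c_A·ε·(Lᵏε)^{−d/2}p(Lᵏε)` of the §3 field `Ã^ε`
(`deltaReg_eq`, `sq_Lk_deltaReg`), the smallness *"for e(Lᵏε) sufficiently small"* from the stopping scale `Lᴷε ≤ ε₀`
(`small_of_thresholds`), and **`err_le_of_thresholds`** — the printed error `O((Lᵏε)^{κ₀})|Λ_k|` of (3.26)/(3.29) DERIVED from
the thresholds for every exponent `κ₀ < 2 − d/2` (the count of HOME/GAPS.md G-B2-07 (ix))

statement-level skeleton of published theorems with citation tags; proofs where landed; nothing here is a claim about the Yang–Mills mass gap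

CITATION HEADER.  T. Bałaban, *(Higgs)₂,₃ quantum fields in a finite volume. II. An upper bound*, Commun. Math. Phys. **86**
(1982) 555–594 [Balaban1982Higgs2] (PDF held `paper:balaban1982-cmp86-higgs23-ii`, journal page = PDF page + 554; pp. 557,
559–560, 570–571, 576–577, 582, 586, 589–590 READ AS IMAGES on the ×2 renders
`run/shared/lean/pub/pub-balaban/b2b-balaban-ref1/pages/1982-cmp86-higgs23-II/1982-cmp86-higgs23-II-p003/p005/p006/p016/p017/p022/p023/p032/p035/p036-x2.png`;
part I [Balaban1982Higgs1] p. 607 (1.22)–(1.23) on `…/1982-cmp85-higgs23-I/1982-cmp85-higgs23-I-p005-x2.png`;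
[Balaban1983RegularityDecay] p. 574 on `…/1983-cmp89-regularity-decay/1983-cmp89-regularity-decay-p004-x2.png`).  Cell `lit-balaban`
(HOME `run/shared/lean/pub/lit-balaban/`), Phase-2 proof seat **p23** gen 10 (unit `lit-balaban-p23-g10`); SKELETON rows **B2.Prop3.1** /
**B2.Eq3.29** (owner r02, second reader r14, referee ref-4) — item (d3) of the «flip condition» (r02 HEAD CRITERION 2026-08-21T21:31Z:
*"a separate ARITHMETIC lemma `err_le_of_thresholds` proving 64d³e(ε-conventions)²(Lᵏδ_k)²Ψ_k²(Lᵏε)^d ≤ M·(Lᵏε)^{κ₀} for ε₀ small / all k,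
from the model scalings"*; GAPS G-B2-07 (ix)).  Consumed by the companion `B2Prop31PrintedRestrictions` (same seat, same gen).
PRECEDENTS BY NAME: r14's `B2LargeField.{lambdaEps, thrPhi}` ((2.2)/(2.5)), p15's `B2Sect3AGaussianStep.one_add_log_inv_rpow_mul_rpow_le`,
`B1Ineq352Proof.pFn_anti`, b2b's `B2.pFn`.

WHAT IS PRINTED.  p. 557 [PDF 3]: *"p(ε) = b₀(1 + log ε⁻¹)ᵖ, p > 2"*, (2.2) the thresholds `|(∂A)(b)| > p(ε)`, `|φ(x)| > (λε^{4−d})^{−1/4}p(ε)`,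
(2.5) *"where λ(ε) = λε^{4−d}"*; p. 570 [PDF 16] (2.55): *"|(∂A)(b)| ≦ c₁p(L^{k−1}ε), … |φ(x)| ≦ (c₁/λ(L^{k−1}ε)^{1/4})p(L^{k−1}ε) for
x ∈ Λ₋₁^{(k−1)′}"*; p. 586 [PDF 32] (3.15): *"|φ_l(x_l)| ≦ O(1)L^{−(l−k)d/4}λ(Lᵏε)^{−1/4}p(Lᵏε)"*; p. 560 [PDF 6] (2.17): *"|B(y) − A(x)| ≦
2Ldp(ε) for x ∈ B(y) … The same estimates as (2.16), (2.17) will hold for the fields in each step with ε replaced by the corresponding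
Lᵏε"*; p. 571 [PDF 17] Lemma 2.3: *"A^{(k)}(x) = A(y) + O(p(Lᵏε)) …, x ∈ Bᵏ(y), y ∈ Λ₂^{(k−1)′}, (2.59) (∂^η_μA^{(k)})(x) = O(p(Lᵏε)),
x ∈ Bᵏ(Λ₂^{(k−1)′}). (2.60)"*; p. 577 (2.98) *"|(∂B̃)(x)| ≦ O(1)p(Lʲε)"*; p. 559 (2.11): *"κ₀ = 1 for d = 3 and κ₀ = 2 − α with arbitary
α > 0 for d = 2"*; Prop. 3.1 p. 589: *"… − Σ_{k=1}^{K}O((Lᵏε)^{κ₀})|(Λ₅⁽ᵏ⁻¹⁾′∩Λ₅⁽ᵏ⁾ᶜ)₁|, (3.26) with κ₀ > 0"*; p. 582: the stopping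
scale `Lᴷε ≤ ε₀`; [Balaban1983RegularityDecay] p. 574 Prop. 3.1′: (3.29) *"for e sufficiently small"* under (1.21) `|(∂^η_μA)(x)| ≦
O(1)p(e)`; part I p. 607 (1.22)–(1.23) and *"the coupling constants e, λ are replaced by λ_s = λs^{−(4−d)}, e_s = es^{−(4−d)/2}"*.

UNITS (the dictionary behind the thresholds; the companion's carrier lives on the PHYSICAL lattices of `HiggsLattice`, the print's
step-k statements on the unit lattice `Lᵏε ↦ 1`).  By (I.1.22)–(I.1.23) a field `f` on the ε-lattice and its rescaling `f′` to the
`L^{−k}`-lattice satisfy `f(x) = s^{−(d−2)/2}f′(x/s)`, `(∂^εf)(x) = s^{−d/2}(∂^{L^{−k}}f′)(x/s)`, `s = Lᵏε`.  Hence: (2.60)/(2.95)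
`|∂A^{(k)}| ≤ O(1)p(Lᵏε)` ↦ fine DIFFERENCE `|A^{(k),ε}(⟨z+εe_ν,μ⟩) − A^{(k),ε}(⟨z,μ⟩)| ≤ c₅·ε·s^{−d/2}·p(s)` (`thr260`); (2.59) and
(2.17) (value statements) ↦ `c₃·s^{−(d−2)/2}p(s)`, `c₄·s^{−(d−2)/2}p(s)` (`thr259`, `thr217`); (2.55)₄/(3.15)₂ `|φ′_k| ≤
O(1)λ(Lᵏε)^{−1/4}p(Lᵏε)` ↦ `‖φ_k(y)‖ ≤ c_φ·s^{−(d−2)/2}·p(s)/λ(s)^{1/4} = c_φλ^{−1/4}s^{−d/4}p(s)` (`thrφ`, `thrφ_eq_thrPhi`);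
`|∂θ_{k+1}| ≤ O(1)` on the step-k unit lattice ↦ `|θ_{k+1}(z+εe_ν) − θ_{k+1}(z)| ≤ c_θ·L^{−k}`.  With these the regularity modulus of
`Ã^ε` on `Bᵏ(Λ_k)` delivered by (2.96)–(2.98) is `δ_k = c_A·ε·s^{−d/2}p(s)`, `c_A = c_θ(2c₃ + c₄) + c₅` (`deltaReg`, `deltaReg_eq`), so that
`e·(Lᵏε)·(Lᵏδ_k) = c_A·e(s)·p(s)` with the running coupling `e(s) = es^{(4−d)/2}` — the smallness `8d⁴Lᵈe²(Lᵏε)²(Lᵏδ_k)² ≤ ½` of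
`B2Ineq329RegularField` IS "e(Lᵏε)p(Lᵏε) small" — and the error `64d³e²(Lᵏδ_k)²Ψ_k²(Lᵏε)^d` of (3.29) becomes
`64d³c_A²c_φ²e²λ^{−1/2}·(Lᵏε)^{2−d/2}p(Lᵏε)⁴`.

WHAT THIS MODULE PROVES (kernel-checked, 0 `sorry`, standard axioms; `Consts`, the thresholds, `CmS`, `SmallEps`, `Mconst` are
definitions with bodies; no `Prop`-valued fact): `thrφ_eq_thrPhi` (the physical sup-threshold IS the tree's (2.2) `thrPhi`
transported by (I.1.22)), `thr259_anti`/`thr260_anti` (thresholds decrease with the scale, `d ≥ 2` — the comparison of (2.95)/(2.97)),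
**`deltaReg_eq`** (`c_θL^{−k}(2·thr259 + thr217) + thr260 = δ_k`, via `L^{−k}s^{−(d−2)/2} = εs^{−d/2}`), **`sq_Lk_deltaReg`**
(`(Lᵏ)²δ_k² = c_A²s^{2−d}p(s)²`), **`small_of_thresholds`** (`SmallEps ⇒ 8d⁴Lᵈe²s²(Lᵏ)²δ_k² ≤ ½` for `s ≤ ε₀`, `d ≤ 3`),
**`err_le_of_thresholds`** (`64d³e²(Lᵏ)²δ_k²·thrφ(s)²s^d ≤ Mconst·s^{κ₀}` for `κ₀ < 2 − d/2`, `s ≤ 1`), `exists_smallEps`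
(non-vacuity of `SmallEps`).
HONEST SCOPE.  (i) The O(1)'s `c₃, c₄, c₅, c_θ, c_φ` and the couplings `e, λ, b₀, p` are parameters (`Consts`); print's values
(`2Ld`, `c₁`, Lemma 2.3's O(1)) are not pinned.  (ii) The exponent obtained is any `κ₀ < 2 − d/2` (d = 3: `< ½`; d = 2: `< 1`),
BELOW the (2.11) `κ₀` (1, 2 − α) — Prop. 3.1 prints «with κ₀ > 0» and downstream ((2.118), (3.31)) uses only `κ₀ > 0` (GAPS
G-pv07-1, G-B2-07 (ix)).  (iii) Thresholds are taken at `p(Lᵏε)` as in (3.15)/(2.95); the one-step conversion `p(L^{k−1}ε) ≤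
(1 + log L)ᵖp(Lᵏε)` of (2.55) is absorbed in the O(1)'s (READING).  (iv) Pure real arithmetic: nothing here refers to fields.
-/

noncomputable section

open Real

namespace Literature.MathematicalPhysics.QuantumFieldTheory.Balaban1983to89.B2Prop31Thresholds

open B2LargeField (lambdaEps thrPhi)

/-! ## §1 The constants, the printed thresholds in physical units, and the arithmetic -/

/-- The constants of the printed inputs and the model couplings: the coupling constant `e` ((I.1.7)), `λ` of `λ(ε) = λε^{4−d}`
((2.5) p. 557), `b₀, p` of `p(ε) = b₀(1 + log ε⁻¹)ᵖ` (p. 557), the O(1)'s `c₃` of (2.59), `c₄` of the restriction (2.17)/(2.97),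
`c₅` of (2.60), `c_θ` of `|∂θ| ≤ O(1)` (p. 567/(2.96)), `c_φ` of (2.55)₄/(3.15)₂, and the stopping scale `ε₀` (`Lᴷε ≤ ε₀`, p. 582).
[cite: Balaban1982Higgs2, pp.557, 560, 567, 570–571, 582, 586] -/
structure Consts where
  e : ℝ
  lam : ℝ
  b₀ : ℝ
  p : ℝ
  c₃ : ℝ
  c₄ : ℝ
  c₅ : ℝ
  cθ : ℝ
  cφ : ℝ
  ε₀ : ℝ

namespace Consts

/-- The printed ranges: `λ > 0` (p. 605 of part I), `b₀ ≥ 0`, `p > 0` (print: p > 2, p. 557), the O(1)'s non-negative,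
`0 < ε₀ ≤ 1`. [cite: Balaban1982Higgs2, pp.557, 582] -/
structure Valid (Γ : Consts) : Prop where
  lam_pos : 0 < Γ.lam
  b₀_nonneg : 0 ≤ Γ.b₀
  p_pos : 0 < Γ.p
  c₃_nonneg : 0 ≤ Γ.c₃
  c₄_nonneg : 0 ≤ Γ.c₄
  c₅_nonneg : 0 ≤ Γ.c₅
  cθ_nonneg : 0 ≤ Γ.cθ
  cφ_nonneg : 0 ≤ Γ.cφ
  ε₀_pos : 0 < Γ.ε₀
  ε₀_le_one : Γ.ε₀ ≤ 1

/-- The combined O(1) of the derived regularity modulus of `Ã^ε`: `c_A = c_θ(2c₃ + c₄) + c₅` ((2.96)–(2.98): `ϑ(α + α′ + β) + γ`).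
[cite: Balaban1982Higgs2, (2.98) p.577] -/
def cA (Γ : Consts) : ℝ := Γ.cθ * (2 * Γ.c₃ + Γ.c₄) + Γ.c₅

/-- `c_A ≥ 0`. [cite: Balaban1982Higgs2, (2.98) p.577] -/
theorem cA_nonneg {Γ : Consts} (h : Γ.Valid) : 0 ≤ Γ.cA := by
  unfold cA
  have := h.c₃_nonneg; have := h.c₄_nonneg; have := h.c₅_nonneg; have := h.cθ_nonneg
  positivity

end Consts

section Thresholds

variable (Γ : Consts)

/-- (2.60)/(2.95) in physical units: `|A^{(k),ε}(⟨z + εe_ν, μ⟩) − A^{(k),ε}(⟨z, μ⟩)| ≤ c₅·ε·s^{−d/2}·p(s)`, `s = Lᵏε` (the unit-lattice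
bound `|∂^ηA^{(k)}| ≦ O(1)p(Lᵏε)` transported by (I.1.23) and multiplied by the fine spacing `ε`).
[cite: Balaban1982Higgs2, (2.60) p.571] [cite: Balaban1982Higgs1, (1.23) p.607] -/
def thr260 (d : ℕ) (ε s : ℝ) : ℝ := Γ.c₅ * ε * s ^ (-(d : ℝ) / 2) * B2.pFn Γ.b₀ Γ.p s

/-- (2.59) in physical units: `|A^{(k),ε}(⟨z, μ⟩) − A_k(z_k)_μ| ≤ c₃·s^{−(d−2)/2}·p(s)`, `s = Lᵏε` ((I.1.22)).
[cite: Balaban1982Higgs2, (2.59) p.571] [cite: Balaban1982Higgs1, (1.22) p.607] -/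
def thr259 (d : ℕ) (s : ℝ) : ℝ := Γ.c₃ * s ^ (-((d : ℝ) - 2) / 2) * B2.pFn Γ.b₀ Γ.p s

/-- (2.17)₁/(2.97) in physical units: `|A_{k+1}(y′)_μ − A_k(y)_μ| ≤ c₄·s^{−(d−2)/2}·p(s)` for `y ∈ B(y′)`, `s = Lᵏε` (*"|B(y) − A(x)|
≦ 2Ldp(ε) for x ∈ B(y)"*, p. 560, *"with ε replaced by the corresponding Lᵏε"*). [cite: Balaban1982Higgs2, (2.17) p.560, (2.97) p.577] -/
def thr217 (d : ℕ) (s : ℝ) : ℝ := Γ.c₄ * s ^ (-((d : ℝ) - 2) / 2) * B2.pFn Γ.b₀ Γ.p s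

/-- (2.55)₄/(3.15)₂ in physical units: `‖φ_k(y)‖ ≤ c_φ·λ^{−1/4}·s^{−d/4}·p(s) = c_φ·s^{−(d−2)/2}·p(s)/λ(s)^{1/4}`, `s = Lᵏε`
(`thrφ_eq_thrPhi`). [cite: Balaban1982Higgs2, (2.55) p.570, (3.15) p.586, (2.2) p.557] -/
def thrφ (d : ℕ) (s : ℝ) : ℝ := Γ.cφ * Γ.lam ^ (-(1 / 4 : ℝ)) * s ^ (-(d : ℝ) / 4) * B2.pFn Γ.b₀ Γ.p s

/-- The DERIVED regularity modulus of `Ã^ε` on `Bᵏ(Λ_k)`: `δ_k = c_A·ε·s^{−d/2}·p(s)`, `s = Lᵏε` ((2.98) in physical units).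
[cite: Balaban1982Higgs2, (2.98) p.577] -/
def deltaReg (d : ℕ) (ε s : ℝ) : ℝ := Γ.cA * ε * s ^ (-(d : ℝ) / 2) * B2.pFn Γ.b₀ Γ.p s

variable {Γ}

/-- `p(s) ≥ 0` on `(0, 1]` (`b₀ ≥ 0`). [cite: Balaban1982Higgs2, p.557] -/
theorem pFn_nonneg' (h : Γ.Valid) {s : ℝ} (hs : 0 < s) (hs1 : s ≤ 1) : 0 ≤ B2.pFn Γ.b₀ Γ.p s := by
  unfold B2.pFn
  refine mul_nonneg h.b₀_nonneg (Real.rpow_nonneg ?_ _)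
  have : 0 ≤ Real.log s⁻¹ := by
    rw [Real.log_inv]; have := Real.log_nonpos hs.le hs1; linarith
  linarith

/-- `1 ≤ 1 + log s⁻¹` on `(0, 1]`. [cite: Balaban1982Higgs2, p.557] -/
theorem one_le_u {s : ℝ} (hs : 0 < s) (hs1 : s ≤ 1) : 1 ≤ 1 + Real.log s⁻¹ := by
  rw [Real.log_inv]; have := Real.log_nonpos hs.le hs1; linarith

/-- **The dictionary check for (2.55)₄**: `c_φ·s^{−(d−2)/2}·thrPhi λ s d (p(s)) = thrφ`, i.e. the physical threshold is the
tree's (2.2) threshold `p(s)/λ(s)^{1/4}` (`B2LargeField.thrPhi`, `λ(s) = λs^{4−d}`) transported by (I.1.22) (`λ > 0`, `s > 0`).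
[cite: Balaban1982Higgs2, (2.2), (2.5) p.557] [cite: Balaban1982Higgs1, (1.22) p.607] -/
theorem thrφ_eq_thrPhi (h : Γ.Valid) (d : ℕ) {s : ℝ} (hs : 0 < s) :
    Γ.cφ * s ^ (-((d : ℝ) - 2) / 2) * thrPhi Γ.lam s d (B2.pFn Γ.b₀ Γ.p s) = thrφ Γ d s := by
  unfold thrφ thrPhi
  rw [B2LargeField.lambdaEps_eq]
  have hz : s ^ ((4 : ℤ) - d) = s ^ ((4 : ℝ) - d) := by
    rw [← Real.rpow_intCast]; push_cast; ring_nf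
  rw [hz, Real.mul_rpow h.lam_pos.le (Real.rpow_nonneg hs.le _), ← Real.rpow_mul hs.le]
  have h1 : Γ.lam ^ (1 / 4 : ℝ) ≠ 0 := (Real.rpow_pos_of_pos h.lam_pos _).ne'
  have h2 : s ^ (((4 : ℝ) - d) * (1 / 4)) ≠ 0 := (Real.rpow_pos_of_pos hs _).ne'
  rw [Real.rpow_neg h.lam_pos.le]
  have h3 : s ^ (-(d : ℝ) / 4) = s ^ (-((d : ℝ) - 2) / 2) / s ^ (((4 : ℝ) - d) * (1 / 4)) := by
    rw [eq_div_iff h2, ← Real.rpow_add hs]; ring_nf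
  rw [h3]
  field_simp

/-- (2.59)-type thresholds decrease with the scale for `d ≥ 2`: `0 < s ≤ t ≤ 1 ⇒ c₃t^{−(d−2)/2}p(t) ≤ c₃s^{−(d−2)/2}p(s)` (`p` antitone,
the power non-positive) — the comparison behind *"(L^{j−l})^{(d−2)/2}O(p(Lˡε)) … ≦ O(1)p(Lʲε)"* (2.95)/(2.97).
[cite: Balaban1982Higgs2, (2.95), (2.97) pp.576–577] -/
theorem thr259_anti (h : Γ.Valid) {d : ℕ} (hd : 2 ≤ d) {s t : ℝ} (hs : 0 < s) (hst : s ≤ t) (ht : t ≤ 1) :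
    thr259 Γ d t ≤ thr259 Γ d s := by
  unfold thr259
  have hd' : (2 : ℝ) ≤ d := by exact_mod_cast hd
  have hexp : -((d : ℝ) - 2) / 2 ≤ 0 := by
    have : 0 ≤ ((d : ℝ) - 2) / 2 := by linarith
    linarith
  have h1 : t ^ (-((d : ℝ) - 2) / 2) ≤ s ^ (-((d : ℝ) - 2) / 2) := Real.rpow_le_rpow_of_nonpos hs hst hexp
  have h2 : B2.pFn Γ.b₀ Γ.p t ≤ B2.pFn Γ.b₀ Γ.p s := B1Ineq352Proof.pFn_anti h.b₀_nonneg h.p_pos.le hs hst ht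
  have hp0 : 0 ≤ B2.pFn Γ.b₀ Γ.p t := pFn_nonneg' h (hs.trans_le hst) ht
  have hs0 : 0 ≤ s ^ (-((d : ℝ) - 2) / 2) := Real.rpow_nonneg hs.le _
  calc Γ.c₃ * t ^ (-((d : ℝ) - 2) / 2) * B2.pFn Γ.b₀ Γ.p t
      ≤ Γ.c₃ * s ^ (-((d : ℝ) - 2) / 2) * B2.pFn Γ.b₀ Γ.p t :=
        mul_le_mul_of_nonneg_right (mul_le_mul_of_nonneg_left h1 h.c₃_nonneg) hp0
    _ ≤ Γ.c₃ * s ^ (-((d : ℝ) - 2) / 2) * B2.pFn Γ.b₀ Γ.p s :=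
        mul_le_mul_of_nonneg_left h2 (mul_nonneg h.c₃_nonneg hs0)

/-- (2.60)-type thresholds decrease with the scale: `0 < s ≤ t ≤ 1 ⇒ c₅εt^{−d/2}p(t) ≤ c₅εs^{−d/2}p(s)` (`ε ≥ 0`) — *"(L^{j−l})^{d/2}p(Lˡε)
≦ O(1)p(Lʲε)"* (2.95). [cite: Balaban1982Higgs2, (2.95) p.576] -/
theorem thr260_anti (h : Γ.Valid) (d : ℕ) {ε s t : ℝ} (hε : 0 ≤ ε) (hs : 0 < s) (hst : s ≤ t) (ht : t ≤ 1) :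
    thr260 Γ d ε t ≤ thr260 Γ d ε s := by
  unfold thr260
  have hexp : -(d : ℝ) / 2 ≤ 0 := by
    have : (0 : ℝ) ≤ d := Nat.cast_nonneg _
    linarith
  have h1 : t ^ (-(d : ℝ) / 2) ≤ s ^ (-(d : ℝ) / 2) := Real.rpow_le_rpow_of_nonpos hs hst hexp
  have h2 : B2.pFn Γ.b₀ Γ.p t ≤ B2.pFn Γ.b₀ Γ.p s := B1Ineq352Proof.pFn_anti h.b₀_nonneg h.p_pos.le hs hst ht
  have hp0 : 0 ≤ B2.pFn Γ.b₀ Γ.p t := pFn_nonneg' h (hs.trans_le hst) ht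
  have hc : 0 ≤ Γ.c₅ * ε := mul_nonneg h.c₅_nonneg hε
  calc Γ.c₅ * ε * t ^ (-(d : ℝ) / 2) * B2.pFn Γ.b₀ Γ.p t
      ≤ Γ.c₅ * ε * s ^ (-(d : ℝ) / 2) * B2.pFn Γ.b₀ Γ.p t :=
        mul_le_mul_of_nonneg_right (mul_le_mul_of_nonneg_left h1 hc) hp0
    _ ≤ Γ.c₅ * ε * s ^ (-(d : ℝ) / 2) * B2.pFn Γ.b₀ Γ.p s :=
        mul_le_mul_of_nonneg_left h2 (mul_nonneg hc (Real.rpow_nonneg hs.le _))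

/-- **The regularity modulus assembled**: with `L^{−k} = ε/s` (`s = Lᵏε`),
`c_θL^{−k}·(thr259 + thr259 + thr217)(s) + thr260(s) = δ_k(s)` — the identity `L^{−k}·s^{−(d−2)/2} = ε·s^{−d/2}` behind
`c_A = c_θ(2c₃ + c₄) + c₅`. [cite: Balaban1982Higgs2, (2.98) p.577] -/
theorem deltaReg_eq (d : ℕ) {ε s ℓ : ℝ} (hs : 0 < s) (hℓ : ℓ * ε = s) :
    Γ.cθ * ℓ⁻¹ * (thr259 Γ d s + thr259 Γ d s + thr217 Γ d s) + thr260 Γ d ε s = deltaReg Γ d ε s := by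
  unfold thr259 thr217 thr260 deltaReg Consts.cA
  have hinv : ℓ⁻¹ = ε * s⁻¹ := by
    rw [← hℓ, mul_inv, ← mul_assoc, mul_comm ε, mul_assoc, mul_inv_cancel₀ ?_, mul_one]
    rintro rfl
    rw [mul_zero] at hℓ
    exact hs.ne' hℓ.symm
  have hpow : s⁻¹ * s ^ (-((d : ℝ) - 2) / 2) = s ^ (-(d : ℝ) / 2) := by
    rw [← Real.rpow_neg_one, ← Real.rpow_add hs]; ring_nf
  rw [hinv]
  calc Γ.cθ * (ε * s⁻¹) * (Γ.c₃ * s ^ (-((d : ℝ) - 2) / 2) * B2.pFn Γ.b₀ Γ.p s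
          + Γ.c₃ * s ^ (-((d : ℝ) - 2) / 2) * B2.pFn Γ.b₀ Γ.p s + Γ.c₄ * s ^ (-((d : ℝ) - 2) / 2) * B2.pFn Γ.b₀ Γ.p s)
        + Γ.c₅ * ε * s ^ (-(d : ℝ) / 2) * B2.pFn Γ.b₀ Γ.p s
      = Γ.cθ * (2 * Γ.c₃ + Γ.c₄) * ε * (s⁻¹ * s ^ (-((d : ℝ) - 2) / 2)) * B2.pFn Γ.b₀ Γ.p s
        + Γ.c₅ * ε * s ^ (-(d : ℝ) / 2) * B2.pFn Γ.b₀ Γ.p s := by ring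
    _ = (Γ.cθ * (2 * Γ.c₃ + Γ.c₄) + Γ.c₅) * ε * s ^ (-(d : ℝ) / 2) * B2.pFn Γ.b₀ Γ.p s := by rw [hpow]; ring

/-- **`(Lᵏ)²δ_k² = c_A²·s^{2−d}·p(s)²`** (`s = Lᵏε`): the combination entering both the smallness and the error of
`B2Ineq329RegularField` — so that `e²(Lᵏε)²(Lᵏδ_k)² = c_A²e(s)²p(s)²` with the running coupling `e(s)² = e²s^{4−d}`.
[cite: Balaban1982Higgs2, (3.29) p.590] [cite: Balaban1982Higgs1, p.607] -/
theorem sq_Lk_deltaReg (d : ℕ) {ε s ℓ : ℝ} (hs : 0 < s) (hℓ : ℓ * ε = s) :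
    ℓ ^ 2 * deltaReg Γ d ε s ^ 2 = Γ.cA ^ 2 * s ^ ((2 : ℝ) - d) * B2.pFn Γ.b₀ Γ.p s ^ 2 := by
  unfold deltaReg
  have h1 : (s ^ (-(d : ℝ) / 2)) ^ 2 = s ^ (-(d : ℝ)) := by
    rw [← Real.rpow_natCast, ← Real.rpow_mul hs.le]; norm_num
  have h2 : s ^ 2 * s ^ (-(d : ℝ)) = s ^ ((2 : ℝ) - d) := by
    rw [show s ^ 2 = s ^ ((2 : ℕ) : ℝ) from (Real.rpow_natCast s 2).symm, ← Real.rpow_add hs]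
    norm_num; ring_nf
  calc ℓ ^ 2 * (Γ.cA * ε * s ^ (-(d : ℝ) / 2) * B2.pFn Γ.b₀ Γ.p s) ^ 2
      = Γ.cA ^ 2 * (ℓ * ε) ^ 2 * (s ^ (-(d : ℝ) / 2)) ^ 2 * B2.pFn Γ.b₀ Γ.p s ^ 2 := by ring
    _ = Γ.cA ^ 2 * (s ^ 2 * s ^ (-(d : ℝ))) * B2.pFn Γ.b₀ Γ.p s ^ 2 := by rw [hℓ, h1]; ring
    _ = Γ.cA ^ 2 * s ^ ((2 : ℝ) - d) * B2.pFn Γ.b₀ Γ.p s ^ 2 := by rw [h2]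

/-- `p(s)² = b₀²(1 + log s⁻¹)^{2p}` on `(0, 1]`. [cite: Balaban1982Higgs2, p.557] -/
theorem pFn_sq {s : ℝ} (hs : 0 < s) (hs1 : s ≤ 1) :
    B2.pFn Γ.b₀ Γ.p s ^ 2 = Γ.b₀ ^ 2 * (1 + Real.log s⁻¹) ^ (2 * Γ.p) := by
  unfold B2.pFn
  have hu : 0 ≤ 1 + Real.log s⁻¹ := le_trans zero_le_one (one_le_u hs hs1)
  have h2 : ((1 + Real.log s⁻¹) ^ Γ.p) ^ 2 = (1 + Real.log s⁻¹) ^ (2 * Γ.p) := by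
    rw [← Real.rpow_natCast ((1 + Real.log s⁻¹) ^ Γ.p) 2, ← Real.rpow_mul hu]
    congr 1; push_cast; ring
  rw [mul_pow, h2]

/-- The smallness constant: `CmS = max(1, 2p/σ)^{2p}`, `σ = (4 − d)/2`, from `(1 + log s⁻¹)^{2p}s^{σ} ≤ CmS` on `(0,1]`.
[cite: Balaban1982Higgs2, (3.29) p.590] -/
def CmS (Γ : Consts) (d : ℕ) : ℝ := max 1 (2 * Γ.p / (((4 : ℝ) - d) / 2)) ^ (2 * Γ.p)

/-- *"for e(Lᵏε) sufficiently small"* as a condition on the stopping scale `ε₀`: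
`16·d⁴·Lᵈ·e²·c_A²·b₀²·CmS·ε₀^{(4−d)/2} ≤ 1` — it yields the smallness hypothesis `8d⁴Lᵈe²(Lᵏε)²(Lᵏδ_k)² ≤ ½` of
`B2Ineq329RegularField` at every scale `Lᵏε ≤ ε₀` (`small_of_thresholds`). [cite: Balaban1982Higgs2, (3.29) p.590, p.582]
[cite: Balaban1983RegularityDecay, Prop. 3.1′ p.574] -/
def SmallEps (d L : ℕ) (Γ : Consts) : Prop :=
  16 * (d : ℝ) ^ 4 * (L : ℝ) ^ d * Γ.e ^ 2 * Γ.cA ^ 2 * Γ.b₀ ^ 2 * CmS Γ d * Γ.ε₀ ^ (((4 : ℝ) - d) / 2) ≤ 1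

/-- **Smallness from the thresholds**: for `d ≤ 3`, `0 < s ≤ ε₀ ≤ 1`, `s = ℓ·ε`, under `SmallEps`:
`8d⁴Lᵈe²s²ℓ²δ_k(s)² ≤ ½` — *"for e sufficiently small"* of [Balaban1983RegularityDecay] Prop. 3.1′ as `e(s)p(s) → 0`.
[cite: Balaban1982Higgs2, (3.29) p.590] [cite: Balaban1983RegularityDecay, Prop. 3.1′ p.574] -/
theorem small_of_thresholds (h : Γ.Valid) {d L : ℕ} (hd : d ≤ 3) (hsm : SmallEps d L Γ) {ε s ℓ : ℝ} (hs : 0 < s)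
    (hsε : s ≤ Γ.ε₀) (hℓ : ℓ * ε = s) :
    8 * (d : ℝ) ^ 4 * (L : ℝ) ^ d * Γ.e ^ 2 * s ^ 2 * ℓ ^ 2 * deltaReg Γ d ε s ^ 2 ≤ 1 / 2 := by
  have hs1 : s ≤ 1 := hsε.trans h.ε₀_le_one
  have hd' : (d : ℝ) ≤ 3 := by exact_mod_cast hd
  set σ : ℝ := ((4 : ℝ) - d) / 2 with hσ
  have hσ0 : 0 < σ := by rw [hσ]; linarith
  have hkey := B2Sect3AGaussianStep.one_add_log_inv_rpow_mul_rpow_le (p := 2 * Γ.p) (s := σ)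
    (by linarith [h.p_pos]) hσ0 hs hs1
  -- `s^{4−d}(1+log s⁻¹)^{2p} = s^σ·((1+log s⁻¹)^{2p}s^σ) ≤ ε₀^σ·CmS`
  have hsplit : s ^ ((2 : ℝ) - d) * s ^ 2 = s ^ σ * s ^ σ := by
    rw [show s ^ 2 = s ^ ((2 : ℕ) : ℝ) from (Real.rpow_natCast s 2).symm, ← Real.rpow_add hs, ← Real.rpow_add hs, hσ]
    norm_num; ring_nf
  have hu0 : 0 ≤ (1 + Real.log s⁻¹) ^ (2 * Γ.p) := Real.rpow_nonneg (le_trans zero_le_one (one_le_u hs hs1)) _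
  have hsσ : s ^ σ ≤ Γ.ε₀ ^ σ := Real.rpow_le_rpow hs.le hsε hσ0.le
  have hsσ0 : 0 ≤ s ^ σ := Real.rpow_nonneg hs.le _
  have hC : 0 ≤ CmS Γ d := by unfold CmS; positivity
  have hmain : s ^ 2 * (ℓ ^ 2 * deltaReg Γ d ε s ^ 2)
      ≤ Γ.cA ^ 2 * Γ.b₀ ^ 2 * CmS Γ d * Γ.ε₀ ^ σ := by
    rw [sq_Lk_deltaReg d hs hℓ, pFn_sq hs hs1]
    calc s ^ 2 * (Γ.cA ^ 2 * s ^ ((2 : ℝ) - d) * (Γ.b₀ ^ 2 * (1 + Real.log s⁻¹) ^ (2 * Γ.p)))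
        = Γ.cA ^ 2 * Γ.b₀ ^ 2 * ((1 + Real.log s⁻¹) ^ (2 * Γ.p) * s ^ σ) * s ^ σ := by
          rw [show s ^ 2 * (Γ.cA ^ 2 * s ^ ((2 : ℝ) - d) * (Γ.b₀ ^ 2 * (1 + Real.log s⁻¹) ^ (2 * Γ.p)))
              = Γ.cA ^ 2 * Γ.b₀ ^ 2 * (1 + Real.log s⁻¹) ^ (2 * Γ.p) * (s ^ ((2 : ℝ) - d) * s ^ 2) by ring, hsplit]
          ring
      _ ≤ Γ.cA ^ 2 * Γ.b₀ ^ 2 * CmS Γ d * Γ.ε₀ ^ σ := by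
          have : (1 + Real.log s⁻¹) ^ (2 * Γ.p) * s ^ σ ≤ CmS Γ d := hkey
          gcongr
  calc 8 * (d : ℝ) ^ 4 * (L : ℝ) ^ d * Γ.e ^ 2 * s ^ 2 * ℓ ^ 2 * deltaReg Γ d ε s ^ 2
      = 8 * (d : ℝ) ^ 4 * (L : ℝ) ^ d * Γ.e ^ 2 * (s ^ 2 * (ℓ ^ 2 * deltaReg Γ d ε s ^ 2)) := by ring
    _ ≤ 8 * (d : ℝ) ^ 4 * (L : ℝ) ^ d * Γ.e ^ 2 * (Γ.cA ^ 2 * Γ.b₀ ^ 2 * CmS Γ d * Γ.ε₀ ^ σ) :=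
        mul_le_mul_of_nonneg_left hmain (by positivity)
    _ = (16 * (d : ℝ) ^ 4 * (L : ℝ) ^ d * Γ.e ^ 2 * Γ.cA ^ 2 * Γ.b₀ ^ 2 * CmS Γ d * Γ.ε₀ ^ σ) / 2 := by ring
    _ ≤ 1 / 2 := by rw [hσ]; exact div_le_div_of_nonneg_right hsm (by norm_num)

/-- The error constant: `Mconst = 64d³e²c_A²c_φ²λ^{−1/2}b₀⁴·max(1, 4p/σ′)^{4p}`, `σ′ = 2 − d/2 − κ₀`.
[cite: Balaban1982Higgs2, Prop. 3.1 (3.26) p.589, (3.29) p.590] -/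
def Mconst (Γ : Consts) (d : ℕ) (κ₀ : ℝ) : ℝ :=
  64 * (d : ℝ) ^ 3 * Γ.e ^ 2 * Γ.cA ^ 2 * Γ.cφ ^ 2 * Γ.lam ^ (-(1 / 2 : ℝ)) * Γ.b₀ ^ 4 *
    max 1 (4 * Γ.p / (2 - (d : ℝ) / 2 - κ₀)) ^ (4 * Γ.p)

/-- `Mconst ≥ 0`. [cite: Balaban1982Higgs2, Prop. 3.1 (3.26) p.589] -/
theorem Mconst_nonneg (h : Γ.Valid) (d : ℕ) (κ₀ : ℝ) : 0 ≤ Mconst Γ d κ₀ := by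
  unfold Mconst
  have := h.lam_pos
  positivity

/-- **`err_le_of_thresholds`** — THE EXPONENT BOOKKEEPING DERIVED (GAPS G-pv07-1 (ii) / G-B2-07 (ix)): for `0 < s ≤ 1`,
`s = ℓ·ε`, `0 < κ₀ < 2 − d/2`, the error of `B2Ineq329RegularField.ineq329_regular_concrete` under the sup-restriction `thrφ`,
`64d³e²ℓ²δ_k² · (thrφ(s)²·s^d) = 64d³c_A²c_φ²e²λ^{−1/2}p(s)⁴s^{2−d/2} ≤ Mconst·s^{κ₀}` — log powers lose against powers
(`one_add_log_inv_rpow_mul_rpow_le`).  For `d = 3` this is any `κ₀ < ½`, for `d = 2` any `κ₀ < 1` (print p. 559 pins κ₀ = 1,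
2 − α; Prop. 3.1 prints *"with κ₀ > 0"*). [cite: Balaban1982Higgs2, Prop. 3.1 (3.26) p.589, (3.29) p.590, (2.11) p.559] -/
theorem err_le_of_thresholds (h : Γ.Valid) (d : ℕ) {κ₀ : ℝ} (hκ : κ₀ < 2 - (d : ℝ) / 2) {ε s ℓ : ℝ} (hs : 0 < s)
    (hs1 : s ≤ 1) (hℓ : ℓ * ε = s) :
    64 * (d : ℝ) ^ 3 * Γ.e ^ 2 * ℓ ^ 2 * deltaReg Γ d ε s ^ 2 * (thrφ Γ d s ^ 2 * s ^ d) ≤ Mconst Γ d κ₀ * s ^ κ₀ := by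
  set σ : ℝ := 2 - (d : ℝ) / 2 - κ₀ with hσ
  have hσ0 : 0 < σ := by rw [hσ]; linarith
  set u : ℝ := 1 + Real.log s⁻¹ with hu
  have hu1 : 1 ≤ u := one_le_u hs hs1
  have hu0 : 0 ≤ u := le_trans zero_le_one hu1
  have hkey := B2Sect3AGaussianStep.one_add_log_inv_rpow_mul_rpow_le (p := 4 * Γ.p) (s := σ)
    (by linarith [h.p_pos]) hσ0 hs hs1
  -- `thrφ(s)²·s^d = c_φ²λ^{−1/2}·s^{d/2}·p(s)²`
  have hφ : thrφ Γ d s ^ 2 * s ^ d = Γ.cφ ^ 2 * Γ.lam ^ (-(1 / 2 : ℝ)) * s ^ ((d : ℝ) / 2) * B2.pFn Γ.b₀ Γ.p s ^ 2 := by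
    unfold thrφ
    have e1 : (Γ.lam ^ (-(1 / 4 : ℝ))) ^ 2 = Γ.lam ^ (-(1 / 2 : ℝ)) := by
      rw [← Real.rpow_natCast, ← Real.rpow_mul h.lam_pos.le]; norm_num
    have e2 : (s ^ (-(d : ℝ) / 4)) ^ 2 * s ^ d = s ^ ((d : ℝ) / 2) := by
      rw [← Real.rpow_natCast (s ^ (-(d : ℝ) / 4)) 2, ← Real.rpow_mul hs.le, ← Real.rpow_natCast s d,
        ← Real.rpow_add hs]
      norm_num; ring_nf
    calc (Γ.cφ * Γ.lam ^ (-(1 / 4 : ℝ)) * s ^ (-(d : ℝ) / 4) * B2.pFn Γ.b₀ Γ.p s) ^ 2 * s ^ d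
        = Γ.cφ ^ 2 * (Γ.lam ^ (-(1 / 4 : ℝ))) ^ 2 * ((s ^ (-(d : ℝ) / 4)) ^ 2 * s ^ d) * B2.pFn Γ.b₀ Γ.p s ^ 2 := by ring
      _ = Γ.cφ ^ 2 * Γ.lam ^ (-(1 / 2 : ℝ)) * s ^ ((d : ℝ) / 2) * B2.pFn Γ.b₀ Γ.p s ^ 2 := by rw [e1, e2]
  -- `p(s)⁴ = b₀⁴u^{4p}` and `s^{2−d}·s^{d/2} = s^{κ₀}·s^{σ}`
  have hp4 : B2.pFn Γ.b₀ Γ.p s ^ 2 * B2.pFn Γ.b₀ Γ.p s ^ 2 = Γ.b₀ ^ 4 * u ^ (4 * Γ.p) := by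
    rw [pFn_sq hs hs1, ← hu]
    have : u ^ (2 * Γ.p) * u ^ (2 * Γ.p) = u ^ (4 * Γ.p) := by
      rw [← Real.rpow_add (lt_of_lt_of_le one_pos hu1)]; ring_nf
    calc Γ.b₀ ^ 2 * u ^ (2 * Γ.p) * (Γ.b₀ ^ 2 * u ^ (2 * Γ.p)) = Γ.b₀ ^ 4 * (u ^ (2 * Γ.p) * u ^ (2 * Γ.p)) := by ring
      _ = Γ.b₀ ^ 4 * u ^ (4 * Γ.p) := by rw [this]
  have hss : s ^ ((2 : ℝ) - d) * s ^ ((d : ℝ) / 2) = s ^ κ₀ * s ^ σ := by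
    rw [← Real.rpow_add hs, ← Real.rpow_add hs, hσ]; ring_nf
  have hsκ : 0 ≤ s ^ κ₀ := Real.rpow_nonneg hs.le _
  rw [mul_assoc (64 * (d : ℝ) ^ 3 * Γ.e ^ 2) (ℓ ^ 2), sq_Lk_deltaReg d hs hℓ, hφ]
  calc 64 * (d : ℝ) ^ 3 * Γ.e ^ 2 * (Γ.cA ^ 2 * s ^ ((2 : ℝ) - d) * B2.pFn Γ.b₀ Γ.p s ^ 2)
        * (Γ.cφ ^ 2 * Γ.lam ^ (-(1 / 2 : ℝ)) * s ^ ((d : ℝ) / 2) * B2.pFn Γ.b₀ Γ.p s ^ 2)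
      = 64 * (d : ℝ) ^ 3 * Γ.e ^ 2 * Γ.cA ^ 2 * Γ.cφ ^ 2 * Γ.lam ^ (-(1 / 2 : ℝ))
        * (B2.pFn Γ.b₀ Γ.p s ^ 2 * B2.pFn Γ.b₀ Γ.p s ^ 2) * (s ^ ((2 : ℝ) - d) * s ^ ((d : ℝ) / 2)) := by ring
    _ = 64 * (d : ℝ) ^ 3 * Γ.e ^ 2 * Γ.cA ^ 2 * Γ.cφ ^ 2 * Γ.lam ^ (-(1 / 2 : ℝ)) * Γ.b₀ ^ 4
        * (u ^ (4 * Γ.p) * s ^ σ) * s ^ κ₀ := by rw [hp4, hss]; ring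
    _ ≤ 64 * (d : ℝ) ^ 3 * Γ.e ^ 2 * Γ.cA ^ 2 * Γ.cφ ^ 2 * Γ.lam ^ (-(1 / 2 : ℝ)) * Γ.b₀ ^ 4
        * (max 1 (4 * Γ.p / σ) ^ (4 * Γ.p)) * s ^ κ₀ := by
        have hc : 0 ≤ 64 * (d : ℝ) ^ 3 * Γ.e ^ 2 * Γ.cA ^ 2 * Γ.cφ ^ 2 * Γ.lam ^ (-(1 / 2 : ℝ)) * Γ.b₀ ^ 4 := by
          have := h.lam_pos; positivity
        exact mul_le_mul_of_nonneg_right (mul_le_mul_of_nonneg_left hkey hc) hsκ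
    _ = Mconst Γ d κ₀ * s ^ κ₀ := by rw [Mconst, hσ]

/-- **Non-vacuity of `SmallEps`**: for any constants (`d ≤ 3`) some `ε₀ ∈ (0, 1]` satisfies it — take
`ε₀ = min(1, B^{−2/(4−d)})` with `B` the prefactor. [cite: Balaban1982Higgs2, p.582] -/
theorem exists_smallEps (Γ : Consts) {d : ℕ} (hd : d ≤ 3) (L : ℕ) :
    ∃ ε₀ : ℝ, 0 < ε₀ ∧ ε₀ ≤ 1 ∧ SmallEps d L { Γ with ε₀ := ε₀ } := by
  have hd' : (d : ℝ) ≤ 3 := by exact_mod_cast hd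
  set σ : ℝ := ((4 : ℝ) - d) / 2 with hσ
  have hσ0 : 0 < σ := by rw [hσ]; linarith
  set B : ℝ := 16 * (d : ℝ) ^ 4 * (L : ℝ) ^ d * Γ.e ^ 2 * Γ.cA ^ 2 * Γ.b₀ ^ 2 * CmS Γ d with hB
  have hB0 : 0 ≤ B := by rw [hB]; unfold CmS; positivity
  have hcA : ({ Γ with ε₀ := min 1 ((B + 1) ^ (-(1 / σ))) } : Consts).cA = Γ.cA := rfl
  have hCm : CmS ({ Γ with ε₀ := min 1 ((B + 1) ^ (-(1 / σ))) } : Consts) d = CmS Γ d := rfl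
  refine ⟨min 1 ((B + 1) ^ (-(1 / σ))), lt_min one_pos (Real.rpow_pos_of_pos (by linarith) _), min_le_left _ _, ?_⟩
  unfold SmallEps
  rw [hcA, hCm]
  simp only []
  rw [← hσ, ← hB]
  have hB1 : 0 < B + 1 := by linarith
  have hle : (min 1 ((B + 1) ^ (-(1 / σ)))) ^ σ ≤ ((B + 1) ^ (-(1 / σ))) ^ σ :=
    Real.rpow_le_rpow (le_min zero_le_one (Real.rpow_nonneg hB1.le _)) (min_le_right _ _) hσ0.le
  have heq : ((B + 1) ^ (-(1 / σ))) ^ σ = (B + 1)⁻¹ := by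
    rw [← Real.rpow_mul hB1.le, show -(1 / σ) * σ = -1 by field_simp, Real.rpow_neg_one]
  calc B * (min 1 ((B + 1) ^ (-(1 / σ)))) ^ σ ≤ B * (B + 1)⁻¹ := by
        rw [← heq]; exact mul_le_mul_of_nonneg_left hle hB0
    _ ≤ 1 := by rw [mul_inv_le_iff₀ hB1]; linarith

end Thresholds

end Literature.MathematicalPhysics.QuantumFieldTheory.Balaban1983to89.B2Prop31Thresholds

end
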